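import Literature.Geometry.Riemannian.RoundSphereVolume
import Mathlib.Analysis.SpecialFunctions.Trigonometric.ArctanDeriv
import HarnessLib

/-!
# The volume of the round unit `3`-sphere: `Vol(S³) = ω₃ = 2π²`

Companion of `RoundSphereVolume.lean` (`Vol(S⁴) = 8π²/3`), same method in dimension three: for
the round metric `g_S = roundMetric V` on the unit sphere `S³ = sphere (0 : V) 1` of a
`4`-dimensional real inner product space (`RoundSphere.lean`; O'Neill 1983, Ch. 3, Def. 3.4) and
the tree's Riemannian measure `dV = riemannianMeasure` (`Lorentzian/Volume.lean`), one
stereographic chart covers the sphere up to a `dV`-null point and carries the density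
`√(det h_{ij}) = (4/(‖y‖²+4))³` (`sqrt_det_chartGramMatrix_roundMetric`, any dimension), so that

* `integral_radial_conformalFactor_three` — `∫₀^∞ t² (4/(t²+4))³ dt = π/2`, by the primitive
  `F(t) = arctan(t/2) + (2t³ − 8t)/(t²+4)²` (`F(0) = 0`, `F(∞) = π/2`);
* `integral_conformalFactor_three` — `∫_{ℝ³} (4/(‖y‖²+4))³ dy = 3 · (4π/3) · π/2 = 2π²` (polar
  coordinates, Mathlib's `integral_fun_norm_addHaar` and `volume_ball_fin_three`);
* `riemannianMeasure_roundMetric_sphere_three_univ` — **`Vol(S³, g_S) = 2π²`** (Aubin 1982,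
  Thm. 6.7: `ω₃ = 2π²/Γ(2) = 2π²`), and in real form
  `toReal_riemannianMeasure_roundMetric_sphere_three_univ`.

This is the constant behind `Vol(S³(2)/Γ) = 16π²/|Γ|` in the classification of three-dimensional
gradient shrinking Ricci solitons (`ThreeShrinkerClassification.lean`, disjunct (a)). Everything is
proved; no definitions, no named facts.

## References

* T. Aubin, *Nonlinear Analysis on Manifolds. Monge–Ampère Equations*, Grundlehren 252, Springer
  1982, Ch. 6, Thm. 6.7 (definition of `ω_n`). [Aubin1982]
* J. M. Lee, *Introduction to Riemannian Manifolds*, 2nd ed., Springer 2018, Prop. 2.41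
  (`dV_g = √(det g_{ij}) dy`), Ch. 3 (stereographic coordinates). [Lee2018]
* H. Federer, *Geometric Measure Theory*, Springer 1969, §3.2.46. [Federer1969]
-/

noncomputable section

open scoped RealInnerProductSpace Manifold ContDiff Topology ENNReal
open Metric Module Bundle Set MeasureTheory Filter

namespace Literature.Geometry.Riemannian

open Literature.Geometry.Lorentzian
open Literature.Geometry.Lorentzian.PseudoRiemannianMetric

/-! ### The radial integral -/

section Integral

/-- `∫₀^∞ t² (4/(t²+4))³ dt = π/2`, with integrability, by the primitive
`F(t) = arctan(t/2) + (2t³ − 8t)/(t²+4)²` (`F(0) = 0`, `F(t) → π/2`). [folklore] -/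
theorem integral_radial_conformalFactor_three :
    ∫ t in Ioi (0 : ℝ), t ^ 2 * (4 / (t ^ 2 + 4)) ^ 3 = Real.pi / 2 ∧
      IntegrableOn (fun t : ℝ ↦ t ^ 2 * (4 / (t ^ 2 + 4)) ^ 3) (Ioi 0) := by
  set F : ℝ → ℝ := fun t ↦ Real.arctan (t / 2) + (2 * t ^ 3 - 8 * t) * ((t ^ 2 + 4) ^ 2)⁻¹
    with hF
  have hne : ∀ t : ℝ, t ^ 2 + 4 ≠ 0 := fun t ↦ by positivity
  have hderiv : ∀ t : ℝ, HasDerivAt F (t ^ 2 * (4 / (t ^ 2 + 4)) ^ 3) t := by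
    intro t
    have h1 : HasDerivAt (fun t : ℝ ↦ t ^ 2 + 4) (2 * t) t := by
      simpa using ((hasDerivAt_id t).pow 2).add_const 4
    have h2' := (h1.pow 2).inv (pow_ne_zero 2 (hne t))
    have hpoly : HasDerivAt (fun t : ℝ ↦ 2 * t ^ 3 - 8 * t) (2 * (3 * t ^ 2) - 8) t := by
      have ha : HasDerivAt (fun t : ℝ ↦ 2 * t ^ 3) (2 * (↑(3 : ℕ) * t ^ (3 - 1))) t :=
        (hasDerivAt_pow 3 t).const_mul 2
      have hb : HasDerivAt (fun t : ℝ ↦ 8 * t) (8 * 1) t := (hasDerivAt_id' t).const_mul 8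
      exact (ha.sub hb).congr_deriv (by push_cast; ring)
    have hatan :
        HasDerivAt (fun t : ℝ ↦ Real.arctan (t / 2)) (1 / (1 + (t / 2) ^ 2) * (1 / 2)) t := by
      have hlin : HasDerivAt (fun t : ℝ ↦ t / 2) (1 / 2) t := by
        simpa using (hasDerivAt_id t).div_const 2
      exact (Real.hasDerivAt_arctan (t / 2)).comp t hlin
    have h := hatan.add (hpoly.mul h2')
    refine h.congr_deriv ?_
    have ht := hne t
    have ht' : (1 + (t / 2) ^ 2) ≠ 0 := by positivity
    simp only [Pi.inv_apply, Pi.pow_apply, Nat.cast_ofNat]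
    field_simp
    ring
  -- the limit at infinity: `arctan(t/2) → π/2` and the rational part `→ 0`
  have hlim : Tendsto F atTop (𝓝 (Real.pi / 2)) := by
    have hatan : Tendsto (fun t : ℝ ↦ Real.arctan (t / 2)) atTop (𝓝 (Real.pi / 2)) :=
      (Real.tendsto_arctan_atTop.mono_right nhdsWithin_le_nhds).comp
        (tendsto_id.atTop_div_const (by norm_num : (0 : ℝ) < 2))
    have hrat : Tendsto (fun t : ℝ ↦ (2 * t ^ 3 - 8 * t) * ((t ^ 2 + 4) ^ 2)⁻¹) atTop (𝓝 0) := by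
      -- squeeze between `± 10/t` for `t ≥ 1`
      have hbound : ∀ t : ℝ, 1 ≤ t → |(2 * t ^ 3 - 8 * t) * ((t ^ 2 + 4) ^ 2)⁻¹| ≤ 10 * t⁻¹ := by
        intro t ht
        have ht0 : 0 < t := by linarith
        rw [abs_mul, abs_inv, abs_of_pos (by positivity : (0 : ℝ) < (t ^ 2 + 4) ^ 2)]
        have ht2 : 1 ≤ t ^ 2 := one_le_pow₀ ht
        have ht3 : t ≤ t ^ 3 := by nlinarith
        have hnum : |2 * t ^ 3 - 8 * t| ≤ 10 * t ^ 3 := by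
          rw [abs_le]
          constructor <;> nlinarith
        have hden : t ^ 4 ≤ (t ^ 2 + 4) ^ 2 := by nlinarith [sq_nonneg t]
        calc |2 * t ^ 3 - 8 * t| * ((t ^ 2 + 4) ^ 2)⁻¹
            ≤ 10 * t ^ 3 * (t ^ 4)⁻¹ := by
              gcongr
          _ = 10 * t⁻¹ := by field_simp
      have h10 : Tendsto (fun t : ℝ ↦ 10 * t⁻¹) atTop (𝓝 0) := by
        simpa using tendsto_inv_atTop_zero.const_mul (10 : ℝ)
      refine squeeze_zero_norm' ?_ h10
      filter_upwards [eventually_ge_atTop (1 : ℝ)] with t ht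
      rw [Real.norm_eq_abs]
      exact hbound t ht
    have := hatan.add hrat
    simpa [hF] using this
  have hpos : ∀ t ∈ Ioi (0 : ℝ), 0 ≤ t ^ 2 * (4 / (t ^ 2 + 4)) ^ 3 := fun t _ ↦ by positivity
  have hcont : ContinuousWithinAt F (Ici 0) 0 := (hderiv 0).continuousAt.continuousWithinAt
  have hF0 : F 0 = 0 := by simp [hF]
  refine ⟨?_, integrableOn_Ioi_deriv_of_nonneg hcont (fun t _ ↦ hderiv t) hpos hlim⟩
  rw [integral_Ioi_of_hasDerivAt_of_nonneg hcont (fun t _ ↦ hderiv t) hpos hlim, hF0, sub_zero]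

/-- **`∫_{ℝ³} (4/(‖y‖²+4))³ dy = 2π²`** (with integrability): polar coordinates
(`integral_fun_norm_addHaar`: `∫ f(‖y‖) dy = 3 |B³| ∫₀^∞ t² f(t) dt`), `|B³| = 4π/3`
(`EuclideanSpace.volume_ball_fin_three`) and `∫₀^∞ t² (4/(t²+4))³ dt = π/2`. [folklore] -/
theorem integral_conformalFactor_three :
    ∫ y : EuclideanSpace ℝ (Fin 3), (4 / (‖y‖ ^ 2 + 4)) ^ 3 = 2 * Real.pi ^ 2 ∧
      Integrable (fun y : EuclideanSpace ℝ (Fin 3) ↦ (4 / (‖y‖ ^ 2 + 4)) ^ 3) := by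
  obtain ⟨hI, hint⟩ := integral_radial_conformalFactor_three
  have hdim : finrank ℝ (EuclideanSpace ℝ (Fin 3)) = 3 := finrank_euclideanSpace_fin
  have hball : (volume : Measure (EuclideanSpace ℝ (Fin 3))).real (ball 0 1) = 4 * Real.pi / 3 := by
    rw [Measure.real, EuclideanSpace.volume_ball_fin_three, ENNReal.toReal_mul,
      ← ENNReal.ofReal_pow zero_le_one, one_pow, ENNReal.toReal_ofReal zero_le_one,
      ENNReal.toReal_ofReal (by positivity)]
    ring
  refine ⟨?_, ?_⟩
  · have h := integral_fun_norm_addHaar (volume : Measure (EuclideanSpace ℝ (Fin 3)))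
      (fun t : ℝ ↦ (4 / (t ^ 2 + 4)) ^ 3)
    rw [h, hdim, hball]
    simp only [smul_eq_mul, nsmul_eq_mul, Nat.cast_ofNat]
    have h3 : ∫ t in Ioi (0 : ℝ), t ^ (3 - 1) * (4 / (t ^ 2 + 4)) ^ 3 = Real.pi / 2 := by
      simpa using hI
    rw [h3]
    ring
  · refine (integrable_fun_norm_addHaar (volume : Measure (EuclideanSpace ℝ (Fin 3)))
      (f := fun t : ℝ ↦ (4 / (t ^ 2 + 4)) ^ 3)).2 ?_
    rw [hdim]
    simpa [smul_eq_mul] using hint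

end Integral

/-! ### The volume of the round `S³` -/

section Volume

variable (V : Type*) [NormedAddCommGroup V] [InnerProductSpace ℝ V] [Fact (finrank ℝ V = 3 + 1)]
  [MeasurableSpace V] [BorelSpace V]

/-- **`Vol(S³) = ω₃ = 2π²`**: the total Riemannian measure of the round metric on the unit
sphere of a `4`-dimensional real inner product space is `2π²` (Aubin 1982, Thm. 6.7: `ω_n` =
volume of the unit `n`-sphere; `ω₃ = 2π²/Γ(2) = 2π²`). Proof as for `S⁴`
(`riemannianMeasure_roundMetric_sphere_four_univ`): the stereographic chart at `v` covers the
sphere up to the `dV`-null point `−v`, and on the chart domain `dV` is Lebesgue measure with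
density `√(det h_{ij}) = (4/(‖y‖²+4))³`, whose integral is `2π²`
(`integral_conformalFactor_three`).
[cite: Aubin1982, Ch. 6, Thm. 6.7] [cite: Lee2018, Prop. 2.41] -/
theorem riemannianMeasure_roundMetric_sphere_three_univ :
    riemannianMeasure
        ((roundMetric (n := 3) V).toContMDiffRiemannianMetric isRiemannian_roundMetric) univ =
      ENNReal.ofReal (2 * Real.pi ^ 2) := by
  haveI : FiniteDimensional ℝ V := .of_fact_finrank_eq_succ 3
  set G := (roundMetric (n := 3) V).toContMDiffRiemannianMetric isRiemannian_roundMetric with hG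
  set μ : Measure (sphere (0 : V) 1) := riemannianMeasure G with hμ
  -- points are null
  have hpt : ∀ x : sphere (0 : V) 1, μ {x} = 0 := by
    intro x
    have h := riemannianMeasure_eq_integral_sqrt_det_holds G x (measurableSet_singleton x)
      (singleton_subset_iff.2 (mem_extChartAt_source x))
    rw [hμ, h, image_singleton]
    exact setLIntegral_measure_zero _ _ (measure_singleton _)
  -- one chart suffices
  haveI : Nontrivial V := Module.nontrivial_of_finrank_eq_succ (Fact.out : finrank ℝ V = 3 + 1)
  obtain ⟨v⟩ : Nonempty (sphere (0 : V) 1) :=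
    (NormedSpace.sphere_nonempty.2 zero_le_one).to_subtype
  have hsrc : (extChartAt (𝓡 3) v).source = {-v}ᶜ := by
    rw [extChartAt_source]
    exact stereographic'_source (-v)
  have htgt : (extChartAt (𝓡 3) v).target = univ := by
    rw [extChartAt_target, ModelWithCorners.range_eq_univ, inter_univ,
      modelWithCornersSelf_coe_symm, preimage_id_eq, id]
    exact stereographic'_target (-v)
  have huniv : μ univ = μ (extChartAt (𝓡 3) v).source := by
    rw [hsrc, measure_compl (measurableSet_singleton _) (by rw [hpt]; exact ENNReal.zero_ne_top),
      hpt, tsub_zero]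
  -- the chart formula
  have hchart : μ (extChartAt (𝓡 3) v).source =
      ∫⁻ y : EuclideanSpace ℝ (Fin 3), ENNReal.ofReal ((4 / (‖y‖ ^ 2 + 4)) ^ 3) := by
    have h1 : μ (extChartAt (𝓡 3) v).source =
        ((μ.restrict (extChartAt (𝓡 3) v).source).map (extChartAt (𝓡 3) v)) univ := by
      rw [Measure.map_apply_of_aemeasurable (aemeasurable_extChartAt_restrict v _)
        MeasurableSet.univ, preimage_univ, Measure.restrict_apply MeasurableSet.univ, univ_inter]
    rw [h1, hμ, map_extChartAt_restrict_riemannianMeasure G v,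
      withDensity_apply _ MeasurableSet.univ, Measure.restrict_univ, htgt, Measure.restrict_univ]
    refine lintegral_congr (fun y ↦ ?_)
    rw [hG, sqrt_det_chartGramMatrix_roundMetric]
  obtain ⟨hI, hint⟩ := integral_conformalFactor_three
  rw [huniv, hchart, ← hI]
  exact (ofReal_integral_eq_lintegral_ofReal hint (Eventually.of_forall fun y ↦ by positivity)).symm

/-- `Vol(S³) = 2π²` as a real number. [cite: Aubin1982, Ch. 6, Thm. 6.7] -/
theorem toReal_riemannianMeasure_roundMetric_sphere_three_univ :
    (riemannianMeasure ((roundMetric (n := 3) V).toContMDiffRiemannianMetric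
        isRiemannian_roundMetric) univ).toReal =
      2 * Real.pi ^ 2 := by
  rw [riemannianMeasure_roundMetric_sphere_three_univ, ENNReal.toReal_ofReal (by positivity)]

end Volume

end Literature.Geometry.Riemannian
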